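import Summits.QuantumFields.GaugeBoot.WordCanon
import Summits.QuantumFields.GaugeBoot.GLYZc1D3TraceRowsA
import HarnessLib

/-!
# Rows as data: the `SU(2)` loop-equation row of a marked word, computed, with ONE soundness theorem (LEQ-SCALING R2)

Cell `pub-gaugeboot` (HOME `run/shared/lean/pub/pub-gaugeboot/`), seat lean2 — design note `HOME/pub-gaugeboot-lean2/LEQ-SCALING.md`.

HONEST FRAMING (page 1 of every file of this cell): certified bounds on lattice expectations at STATED coupling, gauge
group, dimension and torus size; NOT a mass gap, NOT a continuum limit, NOT a string tension, NOT large `N`; NOT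
Yang–Mills-summit-bearing (barriers `FixedCouplingUltralocality`, `PerturbativeInvisibility`).

## Content

`GLYZc1D3Rows{A..F}` / `GLYZc1D3TraceRows{A..G}` derive the 128 rows of ONE generator file with ≈ 25 lines of tactic script per
row.  The larger equality systems of the cell (glyz-c2 3D: 408 rows; kz-L2 3D: 755 / 1939 rows) are handled here ONCE:

* `ERow` — a row as data: terms `(label word, c0, c1)` meaning the coefficient `c0 + c1·β/8` of `Rung0D3.W β L label`
  (eng1 G1's `[c0, c1] = c0 + c1/λ`, `1/λ_KZ = β_std/8` for `SU(2)`); `rowSum β L r` — its value (the SAME expression as lean1's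
  `GLYZc1D3.rowSum`, so bindings `simp`/`rfl` across); `ERow.merge` (aggregate equal labels), `ERow.clean` (drop zero
  coefficients), `ERow.relabel cs` (carry every CLOSED term word to a canonical label by the witness codes `cs`,
  `WordCanon.Word.canonW`; a non-closed word is left alone) — each preserving `rowSum` (`rowSum_merge/_clean/_relabel`).
* `mmRowSU2 X cs` — **eng1's `mm_row` for `SU(2)`, computed in Lean**: the single-link Schwinger–Dyson row of the MARKED closed
  word `X` (mark = letter `0`, read as the link `(0, +e₀)`): `+¼·X` and `+½·(X[0,k)·X[k,n)⁻¹)` at every forward traversal `k` of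
  the link, `−¼·X − ½·(X[0,k]·X(k,n)⁻¹)` at every backward one (occurrences decided on `ℤ³`, `LoopEquationSchema`), and
  `(β/8)·(X·P̃ − X·P̃⁻¹)` over the four plaquettes `P̃` through the link; relabelled, merged, cleaned.
  `rowSum_mmRowSU2` : **`rowSum β L (mmRowSU2 X cs) = 0`** on every torus `(ℤ/L)³` with `B + 2 ≤ L`, for every closed `X` with
  displacement bound `B` and EVERY code list `cs` — from `LoopEquationSU2Loops.loopEquation_su_two_loops` (the tree's one-link
  Schwinger–Dyson identity in `SU(2)` single-loop form).
* `traceRowSU2 C₁ C₂ D₁ D₂ cs` — the difference of the two `SU(2)` trace identities `w(C₁C₂) + w(C₁C₂⁻¹) = 2⟨W(C₁)W(C₂)⟩`,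
  `w(D₁D₂) + w(D₁D₂⁻¹) = 2⟨W(D₁)W(D₂)⟩` (G1 `su2_trace_rows` + `eliminate_su2_double_traces`); `rowSum_traceRowSU2` : it vanishes
  whenever the Boolean `trOK` holds — the four words are closed and two pair scripts (`PairLoopClasses.PMove`, coded by `pmDecode`)
  carry the positioned pairs `(C₁,C₂)`, `(D₁,D₂)` to a common pair (up to order); so each row is one `decide`.
A family of rows is then a list of marked words / decompositions with witness codes (data), one `decide` for the side
conditions, and these two theorems.  (Imports `GLYZc1D3TraceRowsA` only for `su2_rawTrace`.)  Everything is `[folklore]`.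
-/

noncomputable section

open MeasureTheory
open Literature.MathematicalPhysics.QuantumFieldTheory

namespace Summit.QuantumFields.GaugeBoot

/-! ## Rows as data and their value -/

/-- A row: terms `(label word, c0, c1)`, coefficient `c0 + c1·β/8` (G1's `[c0, c1]`). [folklore] -/
abbrev ERow : Type := List (Word 3 × ℚ × ℚ)

/-- The value of a row at standard coupling `β` on `(ℤ/L)³`: `Σ (c0 + c1·β/8)·⟨W_0(w)⟩_β` (same expression as lean1's
`GLYZc1D3.rowSum`). [folklore] -/
def rowSum (β : ℝ) (L : ℕ) [NeZero L] (r : ERow) : ℝ :=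
  (r.map fun t => (((t.2.1 : ℚ) : ℝ) + ((t.2.2 : ℚ) : ℝ) * (β / 8)) * Rung0D3.W β L t.1).sum

variable (β : ℝ) (L : ℕ) [NeZero L]

/-- Unfolding lemma `rowSum_nil`. [folklore] -/
@[simp] theorem rowSum_nil : rowSum β L [] = 0 := rfl

/-- Unfolding lemma `rowSum_cons`. [folklore] -/
@[simp] theorem rowSum_cons (t : Word 3 × ℚ × ℚ) (r : ERow) :
    rowSum β L (t :: r) = (((t.2.1 : ℚ) : ℝ) + ((t.2.2 : ℚ) : ℝ) * (β / 8)) * Rung0D3.W β L t.1 + rowSum β L r := by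
  simp [rowSum]

/-- `rowSum` is additive under concatenation. [folklore] -/
@[simp] theorem rowSum_append (r r' : ERow) : rowSum β L (r ++ r') = rowSum β L r + rowSum β L r' := by
  simp [rowSum, List.sum_append]

namespace ERow

/-- Add one term, merging with an existing term of the same label. [folklore] -/
def addTerm : ERow → Word 3 × ℚ × ℚ → ERow
  | [], t => [t]
  | u :: r, t => if u.1 = t.1 then (u.1, u.2.1 + t.2.1, u.2.2 + t.2.2) :: r else u :: addTerm r t

/-- Merge equal labels (first occurrence keeps its place). [folklore] -/
def merge (r : ERow) : ERow := r.foldl addTerm []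

/-- Drop the terms with zero coefficient. [folklore] -/
def clean (r : ERow) : ERow := r.filter fun t => t.2.1 ≠ 0 ∨ t.2.2 ≠ 0

/-- Relabel one term by a witness code: a CLOSED word is carried to `canonW c`; anything else is left alone (so that the
value is preserved unconditionally). [folklore] -/
def relabelTerm (c : ℕ) (t : Word 3 × ℚ × ℚ) : Word 3 × ℚ × ℚ :=
  if Word.disp t.1 = 0 then (t.1.canonW c, t.2) else t

/-- Relabel the terms by a list of witness codes, consumed in order (missing codes default to `0` = free reduction). [folklore] -/
def relabel : List ℕ → ERow → ERow
  | _, [] => []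
  | [], t :: r => relabelTerm 0 t :: relabel [] r
  | c :: cs, t :: r => relabelTerm c t :: relabel cs r

end ERow

/-- `addTerm` adds the value of the term. [folklore] -/
theorem rowSum_addTerm (r : ERow) (t : Word 3 × ℚ × ℚ) :
    rowSum β L (r.addTerm t) = rowSum β L r + rowSum β L [t] := by
  induction r with
  | nil => simp [ERow.addTerm]
  | cons u r ih =>
    simp only [ERow.addTerm]
    split_ifs with h
    · simp only [rowSum_cons, rowSum_nil, h]
      push_cast
      ring
    · simp only [rowSum_cons, ih, rowSum_nil]
      ring

/-- Merging preserves the value. [folklore] -/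
theorem rowSum_merge (r : ERow) : rowSum β L r.merge = rowSum β L r := by
  suffices h : ∀ (acc : ERow), rowSum β L (r.foldl ERow.addTerm acc) = rowSum β L acc + rowSum β L r by
    simpa [ERow.merge] using h []
  induction r with
  | nil => intro acc; simp
  | cons t r ih =>
    intro acc
    simp only [List.foldl_cons, ih, rowSum_addTerm, rowSum_cons, rowSum_nil]
    ring

/-- Cleaning preserves the value. [folklore] -/
theorem rowSum_clean (r : ERow) : rowSum β L r.clean = rowSum β L r := by
  induction r with
  | nil => simp [ERow.clean]
  | cons t r ih =>
    simp only [ERow.clean, List.filter_cons] at ih ⊢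
    split_ifs with h
    · simp only [rowSum_cons, ih]
    · simp only [decide_eq_true_eq, not_or, not_not] at h
      simp only [rowSum_cons, ih, h.1, h.2]
      push_cast
      ring

/-- Relabelling one term preserves the value (`W_canonW`). [folklore] -/
theorem rowSum_relabelTerm (c : ℕ) (t : Word 3 × ℚ × ℚ) : rowSum β L [ERow.relabelTerm c t] = rowSum β L [t] := by
  unfold ERow.relabelTerm
  split_ifs with h
  · simp only [rowSum_cons, rowSum_nil, W_canonW β L c t.1 h]
  · rfl

/-- Relabelling preserves the value, for EVERY code list. [folklore] -/
theorem rowSum_relabel : ∀ (cs : List ℕ) (r : ERow), rowSum β L (ERow.relabel cs r) = rowSum β L r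
  | _, [] => by simp [ERow.relabel]
  | [], t :: r => by
    have ht := rowSum_relabelTerm β L 0 t
    simp only [rowSum_cons, rowSum_nil, add_zero] at ht
    rw [ERow.relabel, rowSum_cons, rowSum_cons, rowSum_relabel [] r, ht]
  | c :: cs, t :: r => by
    have ht := rowSum_relabelTerm β L c t
    simp only [rowSum_cons, rowSum_nil, add_zero] at ht
    rw [ERow.relabel, rowSum_cons, rowSum_cons, rowSum_relabel cs r, ht]

/-! ## The single-link Schwinger–Dyson row of a marked word (`SU(2)`, eng1 `mm_row` normalisation) -/

/-- Raw terms at letter `k` of the marked word `X` (link `(0, +e₀)`): forward traversal ↦ `¼·X + ½·(X[0,k)·X[k,n)⁻¹)`,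
backward traversal ↦ `−¼·X − ½·(X[0,k]·X(k,n)⁻¹)` (occurrences decided on `ℤ³`). [folklore] -/
def sdTermsAt (X : Word 3) (k : ℕ) : ERow :=
  (if X.fwdOccZ 0 k then [(X, 1 / 4, 0), (X.take k ++ Word.reverse (X.drop k), 1 / 2, 0)] else []) ++
    (if X.bwdOccZ 0 k then [(X, -(1 / 4), 0), (X.take (k + 1) ++ Word.reverse (X.drop (k + 1)), -(1 / 2), 0)] else [])

/-- Raw plaquette terms through the marked link in the plane `(0, ν)`: `(β/8)·(X·P̃ − X·P̃⁻¹)` for both orientations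
`P̃ = +0 ±ν −0 ∓ν`. [folklore] -/
def sdPlaqTerms (X : Word 3) (ν : Fin 3) : ERow :=
  [(X ++ plaqWord 0 ν true, 0, 1), (X ++ (plaqWord 0 ν true).reverse, 0, -1),
    (X ++ plaqWord 0 ν false, 0, 1), (X ++ (plaqWord 0 ν false).reverse, 0, -1)]

/-- All raw terms of the row of `X` (`¼ ×` the identity `loopEquation_su_two_loops`). [folklore] -/
def sdTermsRaw (X : Word 3) : ERow :=
  (List.range X.length).flatMap (sdTermsAt X) ++ (sdPlaqTerms X 1 ++ sdPlaqTerms X 2)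

/-- **eng1's `mm_row` for `SU(2)`**: the row of the marked closed word `X`, every term relabelled by the witness codes
`cs` (in the order of `sdTermsRaw`), equal labels merged, zero coefficients dropped. [folklore] -/
def mmRowSU2 (X : Word 3) (cs : List ℕ) : ERow := (ERow.relabel cs (sdTermsRaw X)).merge.clean

/-- `rowSum` of a `flatMap` over `range n` is a `Finset.range` sum. [folklore] -/
theorem rowSum_flatMap_range (f : ℕ → ERow) :
    ∀ n : ℕ, rowSum β L ((List.range n).flatMap f) = ∑ k ∈ Finset.range n, rowSum β L (f k)
  | 0 => by simp
  | n + 1 => by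
    rw [List.range_succ, List.flatMap_append, rowSum_append, rowSum_flatMap_range f n, Finset.sum_range_succ]
    simp

variable {L}

/-- **The raw terms sum to zero**: `¼ ×` `loopEquation_su_two_loops` at the link `(0, +e₀)` for a closed marked word with
displacement bound `B` on a torus with `B + 2 ≤ L` (standard coupling `β`, tree coupling `β/2`). [folklore] -/
theorem rowSum_sdTermsRaw (X : Word 3) (hX : Word.disp X = 0) {B : ℕ} (hB : X.DispBound B) (hL : B + 2 ≤ L) :
    rowSum β L (sdTermsRaw X) = 0 := by
  have h := loopEquation_su_two_loops_of_dispBound (L := L) (β / (2 : ℕ)) (0 : Site 3 L) 0 X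
    (Word.endpoint_eq_self_of_disp 0 hX) hB hL
  have hW : ∀ v : Word 3,
      wilsonExpectation (suRep 2) (β / (2 : ℕ)) (wordLoop (suRep 2) (0 : Site 3 L) v) = Rung0D3.W β L v := fun v => rfl
  simp only [hW, univ_erase_zero_fin_three] at h
  rw [Finset.sum_pair (show (1 : Fin 3) ≠ 2 by decide), Finset.sum_filter, Finset.sum_filter,
    ← Finset.sum_sub_distrib] at h
  simp only [Fintype.sum_bool] at h
  have hat : ∀ k, rowSum β L (sdTermsAt X k) = (1 / 4 : ℝ) *
      ((if X.fwdOccZ 0 k then Rung0D3.W β L X + 2 * Rung0D3.W β L (X.take k ++ Word.reverse (X.drop k)) else 0) -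
        (if X.bwdOccZ 0 k then Rung0D3.W β L X + 2 * Rung0D3.W β L (X.take (k + 1) ++ Word.reverse (X.drop (k + 1)))
          else 0)) := by
    intro k
    unfold sdTermsAt
    split_ifs <;> simp only [rowSum_append, rowSum_cons, rowSum_nil, List.nil_append, List.append_nil] <;>
      push_cast <;> ring
  rw [sdTermsRaw, rowSum_append, rowSum_append, rowSum_flatMap_range]
  simp only [hat]
  rw [← Finset.mul_sum]
  simp only [sdPlaqTerms, rowSum_cons, rowSum_nil]
  push_cast at h ⊢
  linear_combination (1 / 4 : ℝ) * h

/-- **Soundness of the computed row**: `rowSum β L (mmRowSU2 X cs) = 0` for every closed marked word `X` with displacement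
bound `B`, every witness list `cs`, every torus `(ℤ/L)³` with `B + 2 ≤ L`, every real `β`. [folklore] -/
theorem rowSum_mmRowSU2 (X : Word 3) (cs : List ℕ) (hX : Word.disp X = 0) {B : ℕ} (hB : X.DispBound B)
    (hL : B + 2 ≤ L) : rowSum β L (mmRowSU2 X cs) = 0 := by
  rw [mmRowSU2, rowSum_clean, rowSum_merge, rowSum_relabel, rowSum_sdTermsRaw β X hX hB hL]

/-! ## `SU(2)` trace rows: differences of two trace identities with the same double trace -/

/-- Decode one pair-script code: `1,2,3` joint transpositions `(0 1), (0 2), (1 2)`; `4` joint reflection of axis `0`;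
`5/6` reversal of the left/right component; `7/8` free reduction left/right; `100 + k` / `200 + k`: `k` one-letter
rotations left/right; `10⁶ + m`: joint translation by `t`, `tᵢ = (m / 64ⁱ) % 64 − 32`. [folklore] -/
def pmDecode1 (c : ℕ) : List (PMove 3) :=
  if c = 1 then [PMove.perm (Equiv.swap 0 1)] else if c = 2 then [PMove.perm (Equiv.swap 0 2)]
  else if c = 3 then [PMove.perm (Equiv.swap 1 2)] else if c = 4 then [PMove.refl0]
  else if c = 5 then [PMove.revL] else if c = 6 then [PMove.revR]
  else if c = 7 then [PMove.redL] else if c = 8 then [PMove.redR]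
  else if 100 ≤ c ∧ c < 200 then List.replicate (c - 100) PMove.rotL
  else if 200 ≤ c ∧ c < 300 then List.replicate (c - 200) PMove.rotR
  else if 1000000 ≤ c then
    [PMove.shift ![((c - 1000000) % 64 : ℕ) - 32, ((c - 1000000) / 64 % 64 : ℕ) - 32,
      ((c - 1000000) / 4096 % 64 : ℕ) - 32]]
  else []

/-- Decode a pair script. [folklore] -/
def pmDecode (cs : List ℕ) : List (PMove 3) := cs.flatMap pmDecode1

/-- The positioned pair `(C₁, C₂)` read from the origin of `ℤ³`. [folklore] -/
def pairAt0 (C₁ C₂ : Word 3) : PLoop 3 × PLoop 3 := (⟨0, C₁⟩, ⟨0, C₂⟩)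

/-- **Side condition of a trace row** (Boolean, for `decide`): the four words are closed, both scripts are admissible
along their runs, and they carry the two positioned pairs to the same pair up to order. [folklore] -/
def trOK (C₁ C₂ D₁ D₂ : Word 3) (sa sb : List ℕ) : Bool :=
  decide (Word.disp C₁ = 0) && decide (Word.disp C₂ = 0) && decide (Word.disp D₁ = 0) && decide (Word.disp D₂ = 0) &&
    decide (PMove.closedAlong (pmDecode sa) (pairAt0 C₁ C₂)) && decide (PMove.closedAlong (pmDecode sb) (pairAt0 D₁ D₂)) &&
    (decide (PMove.run (pmDecode sa) (pairAt0 C₁ C₂) = PMove.run (pmDecode sb) (pairAt0 D₁ D₂)) ||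
      decide (PMove.run (pmDecode sa) (pairAt0 C₁ C₂) = (PMove.run (pmDecode sb) (pairAt0 D₁ D₂)).swap))

/-- **The trace row** of two decompositions with the same double trace: `w(C₁C₂) + w(C₁C₂⁻¹) − w(D₁D₂) − w(D₁D₂⁻¹)`
(relabelled by `cs`, merged, cleaned; G1 `su2_trace_rows` + `eliminate_su2_double_traces`). [folklore] -/
def traceRowSU2 (C₁ C₂ D₁ D₂ : Word 3) (cs : List ℕ) : ERow :=
  (ERow.relabel cs [(C₁ ++ C₂, 1, 0), (C₁ ++ Word.reverse C₂, 1, 0), (D₁ ++ D₂, -1, 0),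
    (D₁ ++ Word.reverse D₂, -1, 0)]).merge.clean

/-- **Soundness of the trace row**: it vanishes on every torus and at every coupling when `trOK` holds. [folklore] -/
theorem rowSum_traceRowSU2 (C₁ C₂ D₁ D₂ : Word 3) (sa sb cs : List ℕ) (h : trOK C₁ C₂ D₁ D₂ sa sb = true) :
    rowSum β L (traceRowSU2 C₁ C₂ D₁ D₂ cs) = 0 := by
  simp only [trOK, Bool.and_eq_true, Bool.or_eq_true, decide_eq_true_eq] at h
  obtain ⟨⟨⟨⟨⟨⟨h₁, h₂⟩, h₃⟩, h₄⟩, ha⟩, hb⟩, hrun⟩ := h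
  have ea := su2_rawTrace β (L := L) 0 C₁ C₂ h₁ h₂
  have eb := su2_rawTrace β (L := L) 0 D₁ D₂ h₃ h₄
  have hW : ∀ v : Word 3,
      wilsonExpectation (suRep 2) (β / (2 : ℕ)) (wordLoop (suRep 2) (castZ 0 : Site 3 L) v) = Rung0D3.W β L v := by
    intro v; rw [castZ_zero]; rfl
  simp only [hW] at ea eb
  have pa := pairExp_run (L := L) (suRep 2) (continuous_suRep 2) (β / (2 : ℕ)) (pmDecode sa) (pairAt0 C₁ C₂) ha
  have pb := pairExp_run (L := L) (suRep 2) (continuous_suRep 2) (β / (2 : ℕ)) (pmDecode sb) (pairAt0 D₁ D₂) hb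
  have hpq : pairExp (suRep 2) (β / (2 : ℕ)) L (⟨0, C₁⟩ : PLoop 3) ⟨0, C₂⟩ =
      pairExp (suRep 2) (β / (2 : ℕ)) L (⟨0, D₁⟩ : PLoop 3) ⟨0, D₂⟩ := by
    change pairExp (suRep 2) (β / (2 : ℕ)) L (pairAt0 C₁ C₂).1 (pairAt0 C₁ C₂).2 =
      pairExp (suRep 2) (β / (2 : ℕ)) L (pairAt0 D₁ D₂).1 (pairAt0 D₁ D₂).2
    rw [← pa, ← pb]
    rcases hrun with e | e
    · rw [e]
    · rw [e, Prod.fst_swap, Prod.snd_swap, pairExp_comm]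
  rw [traceRowSU2, rowSum_clean, rowSum_merge, rowSum_relabel]
  simp only [rowSum_cons, rowSum_nil]
  change 2 * pairExp (suRep 2) (β / (2 : ℕ)) L (⟨0, C₁⟩ : PLoop 3) ⟨0, C₂⟩ = _ at ea
  change 2 * pairExp (suRep 2) (β / (2 : ℕ)) L (⟨0, D₁⟩ : PLoop 3) ⟨0, D₂⟩ = _ at eb
  push_cast
  linear_combination eb - ea + 2 * hpq

/-! ## Families of rows as data: the checks a data module runs by `decide` -/

/-- The side condition of a list of SD rows `(marked word, witness codes)`: every marked word is closed with displacement
bound `B` (Boolean, for `decide`). [folklore] -/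
def SDCheck (B : ℕ) (rs : List (Word 3 × List ℕ)) : Bool :=
  rs.all fun r => decide (Word.disp r.1 = 0) && decide (r.1.DispBound B)

/-- **All rows of a checked SD family vanish** on every torus `(ℤ/L)³` with `B + 2 ≤ L`. [folklore] -/
theorem rowSum_of_SDCheck {B : ℕ} {rs : List (Word 3 × List ℕ)} (h : SDCheck B rs = true) (hL : B + 2 ≤ L) :
    ∀ r ∈ rs, rowSum β L (mmRowSU2 r.1 r.2) = 0 := by
  intro r hr
  have h' := List.all_eq_true.1 h r hr
  simp only [Bool.and_eq_true, decide_eq_true_eq] at h'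
  exact rowSum_mmRowSU2 β r.1 r.2 h'.1 h'.2 hL

/-- The data of one trace row: two decompositions `(C₁, C₂)`, `(D₁, D₂)` (read from the origin), their pair scripts
`sa`, `sb` and the witness codes `cs` of the four single-loop terms. [folklore] -/
structure TrData where
  /-- first decomposition, first component -/
  C₁ : Word 3
  /-- first decomposition, second component -/
  C₂ : Word 3
  /-- second decomposition, first component -/
  D₁ : Word 3
  /-- second decomposition, second component -/
  D₂ : Word 3
  /-- pair script for `(C₁, C₂)` (`pmDecode`) -/
  sa : List ℕ
  /-- pair script for `(D₁, D₂)` -/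
  sb : List ℕ
  /-- witness codes of the four single-loop terms -/
  cs : List ℕ

/-- The row of a trace datum. [folklore] -/
def TrData.row (t : TrData) : ERow := traceRowSU2 t.C₁ t.C₂ t.D₁ t.D₂ t.cs

/-- The side condition of a list of trace data (Boolean, for `decide`). [folklore] -/
def TRCheck (ts : List TrData) : Bool := ts.all fun t => trOK t.C₁ t.C₂ t.D₁ t.D₂ t.sa t.sb

variable (L) in
/-- **All rows of a checked trace family vanish** on every torus and at every coupling. [folklore] -/
theorem rowSum_of_TRCheck {ts : List TrData} (h : TRCheck ts = true) : ∀ t ∈ ts, rowSum β L t.row = 0 := by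
  intro t ht
  exact rowSum_traceRowSU2 β t.C₁ t.C₂ t.D₁ t.D₂ t.sa t.sb t.cs (List.all_eq_true.1 h t ht)

/-! ## Examples (closed computations; witness codes found by the seat's search script, any codes would be SOUND) -/

/-- eng1 G1 row 0 of every 3D `SU(2)` family — the plaquette equation: marked word `+0 +1 −0 −1`; output in G1 labels
`abAB:[3/4,0] abABabAB:[0,1] 1:[0,-1] abaBAbAB:[0,1] aabAAB:[0,-1] abABacAC:[0,2] abAcBC:[0,-2]` (= the row
`glyzc1D3_sd0` of `GLYZc1D3RowsA`, there proved by a 25-line script). [folklore] -/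
example : mmRowSU2 [.fwd 0, .fwd 1, .bwd 0, .bwd 1] [0, 64, 0, 0, 28680, 8392, 0, 12488, 4, 12492] =
    [([.fwd 0, .fwd 1, .bwd 0, .bwd 1], 3 / 4, 0), ([.fwd 0, .fwd 1, .bwd 0, .bwd 1, .fwd 0, .fwd 1, .bwd 0, .bwd 1], 0, 1),
      ([], 0, -1), ([.fwd 0, .fwd 1, .fwd 0, .bwd 1, .bwd 0, .fwd 1, .bwd 0, .bwd 1], 0, 1),
      ([.fwd 0, .fwd 0, .fwd 1, .bwd 0, .bwd 0, .bwd 1], 0, -1),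
      ([.fwd 0, .fwd 1, .bwd 0, .bwd 1, .fwd 0, .fwd 2, .bwd 0, .bwd 2], 0, 2),
      ([.fwd 0, .fwd 1, .bwd 0, .fwd 2, .bwd 1, .bwd 2], 0, -2)] := by
  decide +kernel

end Summit.QuantumFields.GaugeBoot

end
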